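import Mathlib
import HarnessLib

/-!
# The `k = 0` Rindler mode with a Kruskal cut-off: an explicit approximate solution of
# `ψ_tt − ψ_xx + μ² e^{2κ(x−x_e)} ψ = 0`

Analysis/PDE support file (everything proved, no definitions).  In Rindler coordinates
`X = κ⁻¹ e^{κ z} cosh(κ t)`, `T = κ⁻¹ e^{κ z} sinh(κ t)` (`z = x − x_e`) the flat metric is
`−dT² + dX² = e^{2κz}(−dt² + dz²)`, so the massive Klein–Gordon equation `φ_TT − φ_XX + μ̂² φ = 0`
becomes the wave equation with EXPONENTIAL potential `ψ_tt − ψ_zz + μ² e^{2κ z} ψ = 0`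
(`μ = μ̂/κ`-normalised below so that the phase is `θ = μ κ⁻¹ e^{κz} sinh(κt) = μ̂ T`).  The
`X`-independent mode `sin(μ̂ T)` ("particle at rest everywhere") is an exact solution; multiplied by
a cut-off `χ(κ X) = χ(e^{κz} cosh(κt))` depending on the Rindler POSITION only, it is an exact
solution up to the commutator with `∂_X²`:

  `ψ(t, x) = χ(e^{κ(x−x_e)} cosh(κt)) · sin(μ κ⁻¹ e^{κ(x−x_e)} sinh(κt))`,
  `ψ_tt − ψ_xx = −e^{2κ(x−x_e)} (μ² χ(u) + κ² χ''(u)) sin θ`,  `u = e^{κ(x−x_e)} cosh(κt)`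
  (`rindlerPacket_wave`),

an identity of elementary calculus (chain rule twice, `cosh² − sinh² = 1`).  Also recorded: the
packet is `C²` (`rindlerPacket_contDiff`), has Cauchy data `(0, μ e^{κ(x−x_e)} χ(e^{κ(x−x_e)}))`
(`rindlerPacket_zero`, `rindlerPacket_deriv_zero`), is odd in `t`, and vanishes wherever the cut-off
argument leaves the support of `χ` (`rindlerPacket_eq_zero`).  With `κ = 1/4M` the surface gravity
and `x` the tortoise coordinate this is the horizon-side "rest packet" of the refutation of the
uniform photon-sphere channel inequality (route `PhotonSphereChannels`, Final State Conjecture): the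
Regge–Wheeler potential is `μ² e^{2κ(x−x_e)}(1 + O(e^{2κ(x−x_c)}))` there.  The function is passed
as `ψ` with a defining hypothesis `hψ`; no definition is introduced.

## References

* N. D. Birrell, P. C. W. Davies, *Quantum Fields in Curved Space*, CUP (1982), §4.5
  (Rindler coordinates and the conformal form of the 2D wave operator; key `BirrellDavies1982`).
-/

noncomputable section

open _root_.Real _root_.Set _root_.Filter _root_.Topology _root_.Function

namespace Literature.Analysis.PDE

/-! ### Second derivative of `τ ↦ χ(u(τ)) sin(θ(τ))` -/

section ChainRule

variable {χ u u₁ u₂ θ θ₁ θ₂ : ℝ → ℝ}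

/-- `C²` functions: `χ'` is `C¹`.  This is Mathlib's `ContDiff.deriv'` at `n = 1`; kept as a
deprecated pointer (dedup-01292), use `hχ.deriv'` directly. [folklore] -/
@[deprecated ContDiff.deriv' (since := "2026-08-16")]
theorem contDiff_one_deriv_of_contDiff_two (hχ : ContDiff ℝ 2 χ) : ContDiff ℝ 1 (deriv χ) :=
  hχ.deriv'

/-- First derivative of `χ(u) sin(θ)`. [folklore] -/
theorem hasDerivAt_chi_mul_sin (hχ : ContDiff ℝ 2 χ) {τ : ℝ} (hu : HasDerivAt u (u₁ τ) τ)
    (hθ : HasDerivAt θ (θ₁ τ) τ) :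
    HasDerivAt (fun σ => χ (u σ) * Real.sin (θ σ))
      (deriv χ (u τ) * u₁ τ * Real.sin (θ τ) + χ (u τ) * (Real.cos (θ τ) * θ₁ τ)) τ := by
  have hχd : HasDerivAt χ (deriv χ (u τ)) (u τ) :=
    ((hχ.differentiable (by norm_num)) (u τ)).hasDerivAt
  have h1 : HasDerivAt (fun σ => χ (u σ)) (deriv χ (u τ) * u₁ τ) τ := hχd.comp τ hu
  have h2 : HasDerivAt (fun σ => Real.sin (θ σ)) (Real.cos (θ τ) * θ₁ τ) τ := hθ.sin
  exact h1.mul h2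

/-- **Second derivative of `χ(u) sin(θ)`** along a curve with `u' = u₁`, `u₁' = u₂`, `θ' = θ₁`,
`θ₁' = θ₂`:
`(χ∘u · sin∘θ)'' = (χ''(u) u₁² + χ'(u) u₂) sin θ + 2 χ'(u) u₁ θ₁ cos θ + χ(u)(θ₂ cos θ − θ₁² sin θ)`.
[folklore] -/
theorem iteratedDeriv_two_chi_mul_sin (hχ : ContDiff ℝ 2 χ) (hu : ∀ σ, HasDerivAt u (u₁ σ) σ)
    (hu₁ : ∀ σ, HasDerivAt u₁ (u₂ σ) σ) (hθ : ∀ σ, HasDerivAt θ (θ₁ σ) σ)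
    (hθ₁ : ∀ σ, HasDerivAt θ₁ (θ₂ σ) σ) (τ : ℝ) :
    iteratedDeriv 2 (fun σ => χ (u σ) * Real.sin (θ σ)) τ
      = (deriv (deriv χ) (u τ) * u₁ τ ^ 2 + deriv χ (u τ) * u₂ τ) * Real.sin (θ τ)
        + 2 * deriv χ (u τ) * u₁ τ * θ₁ τ * Real.cos (θ τ)
        + χ (u τ) * (θ₂ τ * Real.cos (θ τ) - θ₁ τ ^ 2 * Real.sin (θ τ)) := by
  have hd1 : deriv (fun σ => χ (u σ) * Real.sin (θ σ))
      = fun σ => deriv χ (u σ) * u₁ σ * Real.sin (θ σ) + χ (u σ) * (Real.cos (θ σ) * θ₁ σ) :=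
    funext fun σ => (hasDerivAt_chi_mul_sin hχ (hu σ) (hθ σ)).deriv
  rw [iteratedDeriv_succ, iteratedDeriv_one, hd1]
  -- differentiate the first derivative
  have hχ1 : ContDiff ℝ 1 (deriv χ) := hχ.deriv'
  have hχd : HasDerivAt χ (deriv χ (u τ)) (u τ) :=
    ((hχ.differentiable (by norm_num)) (u τ)).hasDerivAt
  have hχ1d : HasDerivAt (deriv χ) (deriv (deriv χ) (u τ)) (u τ) :=
    ((hχ1.differentiable (by norm_num)) (u τ)).hasDerivAt
  have hA : HasDerivAt (fun σ => deriv χ (u σ)) (deriv (deriv χ) (u τ) * u₁ τ) τ := hχ1d.comp τ (hu τ)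
  have hB : HasDerivAt (fun σ => χ (u σ)) (deriv χ (u τ) * u₁ τ) τ := hχd.comp τ (hu τ)
  have hS : HasDerivAt (fun σ => Real.sin (θ σ)) (Real.cos (θ τ) * θ₁ τ) τ := (hθ τ).sin
  have hC : HasDerivAt (fun σ => Real.cos (θ σ)) (-Real.sin (θ τ) * θ₁ τ) τ := (hθ τ).cos
  have h := ((hA.mul (hu₁ τ)).mul hS).add (hB.mul (hC.mul (hθ₁ τ)))
  have h' : HasDerivAt
      (fun σ => deriv χ (u σ) * u₁ σ * Real.sin (θ σ) + χ (u σ) * (Real.cos (θ σ) * θ₁ σ))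
      ((deriv (deriv χ) (u τ) * u₁ τ * u₁ τ + deriv χ (u τ) * u₂ τ) * Real.sin (θ τ)
        + deriv χ (u τ) * u₁ τ * (Real.cos (θ τ) * θ₁ τ)
        + (deriv χ (u τ) * u₁ τ * (Real.cos (θ τ) * θ₁ τ)
          + χ (u τ) * (-Real.sin (θ τ) * θ₁ τ * θ₁ τ + Real.cos (θ τ) * θ₂ τ))) τ :=
    h.congr_of_eventuallyEq (Eventually.of_forall fun _ => rfl)
  rw [h'.deriv]
  ring

end ChainRule

/-! ### The Rindler mode packet -/

section Packet

variable {κ μ xe : ℝ} {χ : ℝ → ℝ} {ψ : ℝ → ℝ → ℝ}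

/-- The packet is `C²`. [folklore] -/
theorem rindlerPacket_contDiff (hχ : ContDiff ℝ 2 χ)
    (hψ : ∀ t x, ψ t x = χ (Real.exp (κ * (x - xe)) * Real.cosh (κ * t))
      * Real.sin (μ / κ * Real.exp (κ * (x - xe)) * Real.sinh (κ * t))) :
    ContDiff ℝ 2 (uncurry ψ) := by
  have heq : uncurry ψ = fun p : ℝ × ℝ => χ (Real.exp (κ * (p.2 - xe)) * Real.cosh (κ * p.1))
      * Real.sin (μ / κ * Real.exp (κ * (p.2 - xe)) * Real.sinh (κ * p.1)) := by
    funext p; exact hψ p.1 p.2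
  rw [heq]
  have h1 : ContDiff ℝ 2 fun p : ℝ × ℝ => Real.exp (κ * (p.2 - xe)) * Real.cosh (κ * p.1) :=
    (Real.contDiff_exp.comp (contDiff_const.mul (contDiff_snd.sub contDiff_const))).mul
      (Real.contDiff_cosh.comp (contDiff_const.mul contDiff_fst))
  have h2 : ContDiff ℝ 2 fun p : ℝ × ℝ =>
      μ / κ * Real.exp (κ * (p.2 - xe)) * Real.sinh (κ * p.1) :=
    (contDiff_const.mul (Real.contDiff_exp.comp
      (contDiff_const.mul (contDiff_snd.sub contDiff_const)))).mul
      (Real.contDiff_sinh.comp (contDiff_const.mul contDiff_fst))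
  exact (hχ.comp h1).mul (Real.contDiff_sin.comp h2)

/-- The packet vanishes at `t = 0`. [folklore] -/
theorem rindlerPacket_zero
    (hψ : ∀ t x, ψ t x = χ (Real.exp (κ * (x - xe)) * Real.cosh (κ * t))
      * Real.sin (μ / κ * Real.exp (κ * (x - xe)) * Real.sinh (κ * t))) (x : ℝ) :
    ψ 0 x = 0 := by
  rw [hψ]; simp

/-- The packet is odd in time. [folklore] -/
theorem rindlerPacket_neg
    (hψ : ∀ t x, ψ t x = χ (Real.exp (κ * (x - xe)) * Real.cosh (κ * t))
      * Real.sin (μ / κ * Real.exp (κ * (x - xe)) * Real.sinh (κ * t))) (t x : ℝ) :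
    ψ (-t) x = -ψ t x := by
  rw [hψ, hψ]
  simp [mul_neg, Real.cosh_neg, Real.sinh_neg, Real.sin_neg]

/-- Time slices: first derivative. [folklore] -/
theorem hasDerivAt_rindlerPacket_time (hχ : ContDiff ℝ 2 χ)
    (hψ : ∀ t x, ψ t x = χ (Real.exp (κ * (x - xe)) * Real.cosh (κ * t))
      * Real.sin (μ / κ * Real.exp (κ * (x - xe)) * Real.sinh (κ * t))) (t x : ℝ) :
    HasDerivAt (fun τ => ψ τ x)
      (deriv χ (Real.exp (κ * (x - xe)) * Real.cosh (κ * t))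
          * (Real.exp (κ * (x - xe)) * (Real.sinh (κ * t) * κ))
          * Real.sin (μ / κ * Real.exp (κ * (x - xe)) * Real.sinh (κ * t))
        + χ (Real.exp (κ * (x - xe)) * Real.cosh (κ * t))
          * (Real.cos (μ / κ * Real.exp (κ * (x - xe)) * Real.sinh (κ * t))
            * (μ / κ * Real.exp (κ * (x - xe)) * (Real.cosh (κ * t) * κ)))) t := by
  have hfun : (fun τ => ψ τ x) = fun τ => χ (Real.exp (κ * (x - xe)) * Real.cosh (κ * τ))
      * Real.sin (μ / κ * Real.exp (κ * (x - xe)) * Real.sinh (κ * τ)) := funext fun τ => hψ τ x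
  rw [hfun]
  have hk : ∀ τ : ℝ, HasDerivAt (fun τ => κ * τ) κ τ := fun τ => by
    simpa using (hasDerivAt_id τ).const_mul κ
  refine hasDerivAt_chi_mul_sin (u₁ := fun τ => Real.exp (κ * (x - xe)) * (Real.sinh (κ * τ) * κ))
    (θ₁ := fun τ => μ / κ * Real.exp (κ * (x - xe)) * (Real.cosh (κ * τ) * κ)) hχ ?_ ?_
  · exact ((hk t).cosh).const_mul _
  · exact ((hk t).sinh).const_mul _

/-- Time slices: `iteratedDeriv 2`. [folklore] -/
theorem iteratedDeriv_rindlerPacket_time (hχ : ContDiff ℝ 2 χ)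
    (hψ : ∀ t x, ψ t x = χ (Real.exp (κ * (x - xe)) * Real.cosh (κ * t))
      * Real.sin (μ / κ * Real.exp (κ * (x - xe)) * Real.sinh (κ * t))) (t x : ℝ) :
    iteratedDeriv 2 (fun τ => ψ τ x) t
      = (deriv (deriv χ) (Real.exp (κ * (x - xe)) * Real.cosh (κ * t))
            * (Real.exp (κ * (x - xe)) * (Real.sinh (κ * t) * κ)) ^ 2
          + deriv χ (Real.exp (κ * (x - xe)) * Real.cosh (κ * t))
            * (Real.exp (κ * (x - xe)) * (Real.cosh (κ * t) * κ * κ)))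
          * Real.sin (μ / κ * Real.exp (κ * (x - xe)) * Real.sinh (κ * t))
        + 2 * deriv χ (Real.exp (κ * (x - xe)) * Real.cosh (κ * t))
          * (Real.exp (κ * (x - xe)) * (Real.sinh (κ * t) * κ))
          * (μ / κ * Real.exp (κ * (x - xe)) * (Real.cosh (κ * t) * κ))
          * Real.cos (μ / κ * Real.exp (κ * (x - xe)) * Real.sinh (κ * t))
        + χ (Real.exp (κ * (x - xe)) * Real.cosh (κ * t))
          * ((μ / κ * Real.exp (κ * (x - xe)) * (Real.sinh (κ * t) * κ * κ))
              * Real.cos (μ / κ * Real.exp (κ * (x - xe)) * Real.sinh (κ * t))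
            - (μ / κ * Real.exp (κ * (x - xe)) * (Real.cosh (κ * t) * κ)) ^ 2
              * Real.sin (μ / κ * Real.exp (κ * (x - xe)) * Real.sinh (κ * t))) := by
  have hfun : (fun τ => ψ τ x) = fun τ => χ (Real.exp (κ * (x - xe)) * Real.cosh (κ * τ))
      * Real.sin (μ / κ * Real.exp (κ * (x - xe)) * Real.sinh (κ * τ)) := funext fun τ => hψ τ x
  rw [hfun]
  have hk : ∀ τ : ℝ, HasDerivAt (fun τ => κ * τ) κ τ := fun τ => by
    simpa using (hasDerivAt_id τ).const_mul κ
  refine iteratedDeriv_two_chi_mul_sin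
    (u := fun τ => Real.exp (κ * (x - xe)) * Real.cosh (κ * τ))
    (u₁ := fun τ => Real.exp (κ * (x - xe)) * (Real.sinh (κ * τ) * κ))
    (u₂ := fun τ => Real.exp (κ * (x - xe)) * (Real.cosh (κ * τ) * κ * κ))
    (θ := fun τ => μ / κ * Real.exp (κ * (x - xe)) * Real.sinh (κ * τ))
    (θ₁ := fun τ => μ / κ * Real.exp (κ * (x - xe)) * (Real.cosh (κ * τ) * κ))
    (θ₂ := fun τ => μ / κ * Real.exp (κ * (x - xe)) * (Real.sinh (κ * τ) * κ * κ))
    hχ (fun τ => ((hk τ).cosh).const_mul _) (fun τ => ?_) (fun τ => ((hk τ).sinh).const_mul _)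
    (fun τ => ?_) t
  · exact (((hk τ).sinh).mul_const κ).const_mul _
  · exact (((hk τ).cosh).mul_const κ).const_mul _

/-- Space slices: first derivative. [folklore] -/
theorem hasDerivAt_rindlerPacket_space (hχ : ContDiff ℝ 2 χ)
    (hψ : ∀ t x, ψ t x = χ (Real.exp (κ * (x - xe)) * Real.cosh (κ * t))
      * Real.sin (μ / κ * Real.exp (κ * (x - xe)) * Real.sinh (κ * t))) (t x : ℝ) :
    HasDerivAt (ψ t)
      (deriv χ (Real.exp (κ * (x - xe)) * Real.cosh (κ * t))
          * (Real.exp (κ * (x - xe)) * κ * Real.cosh (κ * t))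
          * Real.sin (μ / κ * Real.exp (κ * (x - xe)) * Real.sinh (κ * t))
        + χ (Real.exp (κ * (x - xe)) * Real.cosh (κ * t))
          * (Real.cos (μ / κ * Real.exp (κ * (x - xe)) * Real.sinh (κ * t))
            * (μ / κ * (Real.exp (κ * (x - xe)) * κ) * Real.sinh (κ * t)))) x := by
  have hfun : ψ t = fun y => χ (Real.exp (κ * (y - xe)) * Real.cosh (κ * t))
      * Real.sin (μ / κ * Real.exp (κ * (y - xe)) * Real.sinh (κ * t)) := funext fun y => hψ t y
  rw [hfun]
  have hE : ∀ y : ℝ, HasDerivAt (fun y => Real.exp (κ * (y - xe))) (Real.exp (κ * (y - xe)) * κ) y :=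
    fun y => by
      have h1 : HasDerivAt (fun y => κ * (y - xe)) κ y := by
        simpa using ((hasDerivAt_id y).sub_const xe).const_mul κ
      exact h1.exp
  refine hasDerivAt_chi_mul_sin (u₁ := fun y => Real.exp (κ * (y - xe)) * κ * Real.cosh (κ * t))
    (θ₁ := fun y => μ / κ * (Real.exp (κ * (y - xe)) * κ) * Real.sinh (κ * t)) hχ ?_ ?_
  · exact (hE x).mul_const _
  · exact ((hE x).const_mul _).mul_const _

/-- Space slices: `iteratedDeriv 2`. [folklore] -/
theorem iteratedDeriv_rindlerPacket_space (hχ : ContDiff ℝ 2 χ)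
    (hψ : ∀ t x, ψ t x = χ (Real.exp (κ * (x - xe)) * Real.cosh (κ * t))
      * Real.sin (μ / κ * Real.exp (κ * (x - xe)) * Real.sinh (κ * t))) (t x : ℝ) :
    iteratedDeriv 2 (ψ t) x
      = (deriv (deriv χ) (Real.exp (κ * (x - xe)) * Real.cosh (κ * t))
            * (Real.exp (κ * (x - xe)) * κ * Real.cosh (κ * t)) ^ 2
          + deriv χ (Real.exp (κ * (x - xe)) * Real.cosh (κ * t))
            * (Real.exp (κ * (x - xe)) * κ * κ * Real.cosh (κ * t)))
          * Real.sin (μ / κ * Real.exp (κ * (x - xe)) * Real.sinh (κ * t))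
        + 2 * deriv χ (Real.exp (κ * (x - xe)) * Real.cosh (κ * t))
          * (Real.exp (κ * (x - xe)) * κ * Real.cosh (κ * t))
          * (μ / κ * (Real.exp (κ * (x - xe)) * κ) * Real.sinh (κ * t))
          * Real.cos (μ / κ * Real.exp (κ * (x - xe)) * Real.sinh (κ * t))
        + χ (Real.exp (κ * (x - xe)) * Real.cosh (κ * t))
          * ((μ / κ * (Real.exp (κ * (x - xe)) * κ * κ) * Real.sinh (κ * t))
              * Real.cos (μ / κ * Real.exp (κ * (x - xe)) * Real.sinh (κ * t))
            - (μ / κ * (Real.exp (κ * (x - xe)) * κ) * Real.sinh (κ * t)) ^ 2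
              * Real.sin (μ / κ * Real.exp (κ * (x - xe)) * Real.sinh (κ * t))) := by
  have hfun : ψ t = fun y => χ (Real.exp (κ * (y - xe)) * Real.cosh (κ * t))
      * Real.sin (μ / κ * Real.exp (κ * (y - xe)) * Real.sinh (κ * t)) := funext fun y => hψ t y
  rw [hfun]
  have hE : ∀ y : ℝ, HasDerivAt (fun y => Real.exp (κ * (y - xe))) (Real.exp (κ * (y - xe)) * κ) y :=
    fun y => by
      have h1 : HasDerivAt (fun y => κ * (y - xe)) κ y := by
        simpa using ((hasDerivAt_id y).sub_const xe).const_mul κ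
      exact h1.exp
  have hE2 : ∀ y : ℝ, HasDerivAt (fun y => Real.exp (κ * (y - xe)) * κ)
      (Real.exp (κ * (y - xe)) * κ * κ) y := fun y => (hE y).mul_const κ
  refine iteratedDeriv_two_chi_mul_sin
    (u := fun y => Real.exp (κ * (y - xe)) * Real.cosh (κ * t))
    (u₁ := fun y => Real.exp (κ * (y - xe)) * κ * Real.cosh (κ * t))
    (u₂ := fun y => Real.exp (κ * (y - xe)) * κ * κ * Real.cosh (κ * t))
    (θ := fun y => μ / κ * Real.exp (κ * (y - xe)) * Real.sinh (κ * t))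
    (θ₁ := fun y => μ / κ * (Real.exp (κ * (y - xe)) * κ) * Real.sinh (κ * t))
    (θ₂ := fun y => μ / κ * (Real.exp (κ * (y - xe)) * κ * κ) * Real.sinh (κ * t))
    hχ (fun y => (hE y).mul_const _) (fun y => (hE2 y).mul_const _)
    (fun y => ((hE y).const_mul _).mul_const _) (fun y => ((hE2 y).const_mul _).mul_const _) x

/-- **The Rindler mode packet is an exact solution up to the cut-off commutator**:
`ψ_tt − ψ_xx = −e^{2κ(x−x_e)} (μ² χ(u) + κ² χ''(u)) sin θ`, `u = e^{κ(x−x_e)} cosh(κt)`,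
`θ = μ κ⁻¹ e^{κ(x−x_e)} sinh(κt)` (`κ ≠ 0`).  Equivalently `ψ_tt − ψ_xx + μ² e^{2κ(x−x_e)} ψ =
−κ² e^{2κ(x−x_e)} χ''(u) sin θ`. [cite: BirrellDavies1982, §4.5] -/
theorem rindlerPacket_wave (hχ : ContDiff ℝ 2 χ) (hκ : κ ≠ 0)
    (hψ : ∀ t x, ψ t x = χ (Real.exp (κ * (x - xe)) * Real.cosh (κ * t))
      * Real.sin (μ / κ * Real.exp (κ * (x - xe)) * Real.sinh (κ * t))) (t x : ℝ) :
    iteratedDeriv 2 (fun τ => ψ τ x) t - iteratedDeriv 2 (ψ t) x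
      = -(Real.exp (κ * (x - xe)) ^ 2
          * (μ ^ 2 * χ (Real.exp (κ * (x - xe)) * Real.cosh (κ * t))
            + κ ^ 2 * deriv (deriv χ) (Real.exp (κ * (x - xe)) * Real.cosh (κ * t)))
          * Real.sin (μ / κ * Real.exp (κ * (x - xe)) * Real.sinh (κ * t))) := by
  rw [iteratedDeriv_rindlerPacket_time hχ hψ, iteratedDeriv_rindlerPacket_space hχ hψ]
  set E := Real.exp (κ * (x - xe))
  set C := Real.cosh (κ * t)
  set S := Real.sinh (κ * t)
  have hCS : C ^ 2 = S ^ 2 + 1 := Real.cosh_sq (κ * t)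
  set χ0 := χ (E * C)
  set χ1 := deriv χ (E * C)
  set χ2 := deriv (deriv χ) (E * C)
  set sθ := Real.sin (μ / κ * E * S)
  set cθ := Real.cos (μ / κ * E * S)
  field_simp
  linear_combination (-(E ^ 2 * sθ * (κ ^ 2 * χ2 + μ ^ 2 * χ0))) * hCS

/-- The time derivative of the packet at `t = 0` (the VELOCITY datum of the rest packet):
`ψ_t(0, x) = μ e^{κ(x−x_e)} χ(e^{κ(x−x_e)})` (`κ ≠ 0`). [folklore] -/
theorem rindlerPacket_deriv_zero (hχ : ContDiff ℝ 2 χ) (hκ : κ ≠ 0)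
    (hψ : ∀ t x, ψ t x = χ (Real.exp (κ * (x - xe)) * Real.cosh (κ * t))
      * Real.sin (μ / κ * Real.exp (κ * (x - xe)) * Real.sinh (κ * t))) (x : ℝ) :
    deriv (fun τ => ψ τ x) 0 = μ * Real.exp (κ * (x - xe)) * χ (Real.exp (κ * (x - xe))) := by
  rw [(hasDerivAt_rindlerPacket_time hχ hψ 0 x).deriv]
  simp only [mul_zero, Real.cosh_zero, Real.sinh_zero, mul_one, zero_mul, mul_zero,
    Real.sin_zero, Real.cos_zero, one_mul, zero_add]
  field_simp

/-- **Support of the packet**: if `χ` vanishes off `(a, b)` then `ψ(t, x) = 0` whenever the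
Rindler position `u = e^{κ(x−x_e)} cosh(κt)` satisfies `u ≤ a` or `b ≤ u`. [folklore] -/
theorem rindlerPacket_eq_zero {a b : ℝ} (hχ0 : ∀ u, u ≤ a ∨ b ≤ u → χ u = 0)
    (hψ : ∀ t x, ψ t x = χ (Real.exp (κ * (x - xe)) * Real.cosh (κ * t))
      * Real.sin (μ / κ * Real.exp (κ * (x - xe)) * Real.sinh (κ * t))) {t x : ℝ}
    (h : Real.exp (κ * (x - xe)) * Real.cosh (κ * t) ≤ a
      ∨ b ≤ Real.exp (κ * (x - xe)) * Real.cosh (κ * t)) :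
    ψ t x = 0 := by
  rw [hψ, hχ0 _ h, zero_mul]

/-- The set where the Rindler position stays below `a` is open (used to transfer the vanishing of
the packet to its derivatives). [folklore] -/
theorem isOpen_rindlerPosition_lt (κ xe a : ℝ) :
    IsOpen {p : ℝ × ℝ | Real.exp (κ * (p.2 - xe)) * Real.cosh (κ * p.1) < a} :=
  isOpen_lt (by fun_prop) continuous_const

/-- The set where the Rindler position stays above `b` is open. [folklore] -/
theorem isOpen_lt_rindlerPosition (κ xe b : ℝ) :
    IsOpen {p : ℝ × ℝ | b < Real.exp (κ * (p.2 - xe)) * Real.cosh (κ * p.1)} :=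
  isOpen_lt continuous_const (by fun_prop)

end Packet

end Literature.Analysis.PDE

end
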